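import Summits.QuantumFields.BalabanUV.Beta.FP.CoarseCovarianceStripWReg
import Summits.QuantumFields.BalabanUV.Beta.FP.CoarseCovarianceAliasBF
import Summits.QuantumFields.BalabanUV.Beta.FP.PerfectPropagatorSplit
import Summits.QuantumFields.BalabanUV.Beta.FP.PerfectMaxwellDict
import Summits.QuantumFields.BalabanUV.Beta.FP.PerfectRemainderSliceLocal

/-!
# `BalabanUV.Beta.FP.CoarseCovarianceStripFeyn` — road «FP» (binder row D1), row H′2-IR ∕ IR-2 (ii), file (F): **the HOLOMORPHIC Feynman-completed
# Maxwell matrix `F(p) = feynC p` of the perfect action** (`conj p̂(s)` continued as `p̂(−p)`, the weights as the periodic `W_∞^{per}` of file (W)),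
# its scalar∕excess split `F = Δ¹(p)·𝟙 + R`, its entry regularity on the periodic strip, and the DICTIONARY at real momenta:
# `F(s) = feynMat (Re W_∞(wrap s)) (p̂(wrap s))`, so `F(s)⁻¹ = PbfSym (s)` — leaf-02-g7's coarse-covariance symbol of record is `covSymMean` of `(feynC ·)⁻¹`

HONEST FRAMING (cell contract, verbatim): «discharging `BetaPertH` makes Bałaban's UV stability UNCONDITIONAL — a real constructive-QFT
result; it is NOT the continuum limit and NOT the Clay problem.»  HONEST DEPENDENCY (verbatim): «continuum YM on T⁴ ⇐ BetaPertH ∧ nine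
spine estimates (0/9 proved); BetaPertH ⇐ (D1) ∧ (D4) ∧ CAP+tail; G-an2-4 gates asym, D1 and NE2/3/4.»  THIS MODULE DISCHARGES NOTHING of
D1 ∕ BetaPertH: [folklore] matrix∕trigonometric algebra and one-variable holomorphy bookkeeping over the cell's OWN objects (`curlRow`, `feynMat`,
`PinfSym` of gan24-leaf-05-g34; `PbfSym`, `wrapPt` of leaf-02-g7; `Wper` of file (W)) BY NAME.  Four [our object] data defs (`d1C`, `exC`, `feynC`, `PC`);
no `def … : Prop`; nothing is cited; 0 sorry.  NOT summit progress; NOT BetaPertH, NOT continuum, NOT Clay.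

ABSOLUTE RULE (cell, verbatim): «No internally-minted statement may enter as a cited fact. Every hypothesis is either kernel-proved in this
package or a verbatim quotation of a PUBLISHED theorem with page reference. The manuscript(s) under audit are NOT citable for their own
disputed steps — they are the thing under adjudication; programme-internal (2001/route/tribunal) claims are never citable.»

CONTENT (`D = d+1`; INTENT journal l.22234; owner design memo `HOME/b2b-balaban-beta-d1-p3/H2IR-DESIGN.md` §IR-2).
* §1 [our object] `d1C p a := exp(i p_a) − 1` (the momentum factor `p̂`, ENTIRE; `d1C (ofRealVec s) = d1Sym s`), its `2π`-periodicity (`d1C_wrapC`,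
  `d1Sym_wrapPt`), `conj (p̂(s)) = p̂(−s)` at real `s` (`conj_d1C_ofRealVec`), `Σ_a p̂_a(−p) p̂_a(p) = Δ¹(p)` (`B4Strip.Delta1 0`, `sum_d1C_neg_mul`).
* §2 [our object] `exC V p` (the weighted Maxwell matrix with weights `V` and the two momentum vectors `p̂(−p)`, `p̂(p)`), **`feynC p := exC (W^{per}(p)) p + p̂(p) ⊗ p̂(−p)`**,
  `PC p := (feynC p)⁻¹`; [folklore] `exC_one` (constant weights: `exC 1 p = Δ¹(p)·𝟙 − p̂(p) ⊗ p̂(−p)`), `exC_sub`, hence the SPLIT **`feynC_eq_Delta1_add_exC`**: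
  `feynC p α β = [α = β]·Δ¹(p) + exC (W^{per}(p) − 1) p α β`.
* §3 THE DICTIONARY AT REAL MOMENTA: `wrapC_ofRealVec` (file (W)'s complex wrap is leaf-02's `wrapPt` on reals), `Wper_ofRealVec` (real, `= Re W_∞(wrap s)`,
  via `PerfectMaxwellDict.W166Inf_ofReal_eq_re_of_mem` BY NAME),
  **`feynC_ofRealVec : feynC (ofRealVec s) = feynMat (Re W_∞(·,·; wrapPt s)) (d1Sym (wrapPt s))`**, **`PC_ofRealVec : PC (ofRealVec s) κ λ = PbfSym κ λ (ofRealVec s)`**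
  (every real `s`), `W166Inf_ofRealVec_wrapPt` ∕ **`PC_ofRealVec_of_mem_BZ : s ∈ BZ → PC (ofRealVec s) κ λ = PinfSym s (d1Sym s) κ λ`** (the `hG₀` hypothesis of
  leaf-02's `coarseCovMean_latticeKernel_BF` ∕ `latticeKernel_eq_PbfSym`, on the CLOSED zone, by the several-coordinate side matching `W166Inf_shiftS`).
* REGULARITY on the periodic strip and ENTRY BOUNDS: the sequel `FP/CoarseCovarianceStripFeynReg`.
Unit `b2b-balaban-beta-d1-formalise-leaf-06` (gen 7; v1.1 gen 8: the two [folklore] letters `feynMat_congr_offDiag` ∕ `W166Inf_ofReal_eq_re_of_mem`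
are the tree's (`PerfectRemainderSliceLocal` ∕ `PerfectMaxwellDict`) BY NAME, per the gate's dedup.landed on p239634), owner ruling R-FP-21 (A3)∕(C).
-/

noncomputable section

namespace Summit.QuantumFields.BalabanUV.Beta.FP.CoarseCovarianceStripFeyn

open Filter Topology Finset Complex Set Metric Matrix
open scoped BigOperators ComplexConjugate
open Literature.MathematicalPhysics.QuantumFieldTheory.Balaban1983to89
open B4Strip (Strip ofRealVec reVec S1 Delta1)
open B4ContourShift (BZ)
open B5Prop11Fiber (d1Sym)
open B5Symbol166Strip (kappa166 kappa166_pos)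
open Summit.QuantumFields.BalabanUV.Beta.FP.PerfectSymbol166 (W166Inf W166Inf_zero)
open Summit.QuantumFields.BalabanUV.Beta.FP.PerfectMaxwellDict (W166Inf_ofReal_eq_re_of_mem)
open Summit.QuantumFields.BalabanUV.Beta.FP.PerfectRemainderSliceLocal (feynMat_congr_offDiag)
open Summit.QuantumFields.BalabanUV.Beta.FP.PerfectPropagatorSymbol (curlRow maxwellMat feynMat PinfSym)
open Summit.QuantumFields.BalabanUV.Beta.FP.PerfectPropagatorSplit (curlRow_self norm_curlRow_le)
open Summit.QuantumFields.BalabanUV.Beta.FP.CoarseCovarianceAliasBF (wrapPt wrapPt_mem_Ioc wrapPt_mem_BZ wrapPt_eq_self PbfSym PbfSym_ofRealVec)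
open Summit.QuantumFields.BalabanUV.Beta.FP.CoarseCovarianceStripW
open Summit.QuantumFields.BalabanUV.Beta.FP.CoarseCovarianceStripWReg (continuousOn_Wper differentiableAt_Wper_update)

variable {d : ℕ}

/-! ## §1 The momentum factor `p̂`, entire -/

/-- [our object] the momentum factor `p̂_a(p) := e^{i p_a} − 1`, for complex `p`. -/
def d1C (p : Fin (d + 1) → ℂ) : Fin (d + 1) → ℂ := fun a => Complex.exp (p a * I) - 1

/-- [folklore] unfolding. -/
theorem d1C_apply (p : Fin (d + 1) → ℂ) (a : Fin (d + 1)) : d1C p a = Complex.exp (p a * I) - 1 := rfl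

/-- [folklore] at real momenta `p̂` is the tree's `d1Sym`. -/
theorem d1C_ofRealVec (s : Fin (d + 1) → ℝ) : d1C (ofRealVec s) = d1Sym s := rfl

/-- [folklore] `p̂` only sees `p` modulo `2πℤ^D`: `p̂(p − 2πm) = p̂(p)`. -/
theorem d1C_sub_int (p : Fin (d + 1) → ℂ) (m : Fin (d + 1) → ℤ) : d1C (fun a => p a - (m a : ℂ) * (2 * Real.pi)) = d1C p := by
  funext a
  have h : Complex.exp ((m a : ℂ) * (2 * Real.pi) * I) = 1 := by
    have := Complex.exp_int_mul_two_pi_mul_I (m a)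
    rw [← this]; congr 1; ring
  simp only [d1C_apply, sub_mul, Complex.exp_sub, h, div_one]

/-- [folklore] the wrap of file (W) subtracts an integer multiple of `2π`: `wrapRe z = z − m·2π`, `m = toIocDiv 2π (−π) (Re z)`. -/
theorem wrapRe_eq_sub (z : ℂ) : wrapRe z = z - (toIocDiv Real.two_pi_pos (-Real.pi) z.re : ℂ) * (2 * Real.pi) := by
  apply Complex.ext
  · have h := toIocMod_add_toIocDiv_zsmul Real.two_pi_pos (-Real.pi) z.re
    rw [zsmul_eq_mul] at h
    simp only [wrapRe_re, Complex.sub_re, Complex.mul_re, Complex.intCast_re, Complex.intCast_im, Complex.mul_im,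
      Complex.re_ofNat, Complex.ofReal_re, Complex.im_ofNat, Complex.ofReal_im, mul_zero, sub_zero, zero_mul]
    linarith
  · simp [wrapRe_im]

/-- [folklore] `p̂(wrapC p) = p̂(p)`. -/
theorem d1C_wrapC (p : Fin (d + 1) → ℂ) : d1C (wrapC p) = d1C p := by
  have e : wrapC p = fun a => p a - ((toIocDiv Real.two_pi_pos (-Real.pi) (p a).re : ℤ) : ℂ) * (2 * Real.pi) :=
    funext fun a => wrapRe_eq_sub (p a)
  rw [e, d1C_sub_int]

/-- [folklore] the complex wrap of file (W) is leaf-02-g7's `wrapPt` on real vectors. -/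
theorem wrapC_ofRealVec (s : Fin (d + 1) → ℝ) : wrapC (ofRealVec s) = ofRealVec (wrapPt s) := by
  funext i
  apply Complex.ext
  · simp [wrapC_apply, wrapRe_re, wrapPt, ofRealVec]
  · simp [wrapC_apply, wrapRe_im, ofRealVec]

/-- [folklore] `d1Sym (wrapPt s) = p̂(s)`. -/
theorem d1Sym_wrapPt (s : Fin (d + 1) → ℝ) : d1Sym (wrapPt s) = d1C (ofRealVec s) := by
  rw [← d1C_ofRealVec, ← wrapC_ofRealVec, d1C_wrapC]

/-- [folklore] `p̂(−p)` unfolds to `e^{−i p_a} − 1`. -/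
theorem d1C_neg_apply (p : Fin (d + 1) → ℂ) (a : Fin (d + 1)) : d1C (-p) a = Complex.exp (-(p a * I)) - 1 := by
  simp [d1C_apply, neg_mul]

/-- [folklore] **`conj p̂(s) = p̂(−s)` AT REAL MOMENTA.** -/
theorem conj_d1C_ofRealVec (s : Fin (d + 1) → ℝ) (a : Fin (d + 1)) : conj (d1C (ofRealVec s) a) = d1C (-ofRealVec s) a := by
  rw [d1C_neg_apply, d1C_apply, map_sub, map_one, ← Complex.exp_conj]
  congr 2
  simp [ofRealVec, Complex.conj_ofReal, Complex.conj_I]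

/-- [folklore] as functions. -/
theorem star_d1C_ofRealVec (s : Fin (d + 1) → ℝ) : (fun a => conj (d1C (ofRealVec s) a)) = d1C (-ofRealVec s) :=
  funext fun a => conj_d1C_ofRealVec s a

/-- [folklore] `p̂_a(−p)·p̂_a(p) = S₁(p_a) = 2 − 2cos p_a`. -/
theorem d1C_neg_mul_d1C (p : Fin (d + 1) → ℂ) (a : Fin (d + 1)) : d1C (-p) a * d1C p a = S1 (p a) := by
  rw [d1C_neg_apply, d1C_apply, S1]
  have h2 := Complex.two_cos (p a)
  have hprod : Complex.exp (-(p a * I)) * Complex.exp (p a * I) = 1 := by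
    rw [← Complex.exp_add, neg_add_cancel, Complex.exp_zero]
  have e : (Complex.exp (-(p a * I)) - 1) * (Complex.exp (p a * I) - 1)
      = Complex.exp (-(p a * I)) * Complex.exp (p a * I) - (Complex.exp (p a * I) + Complex.exp (-(p a) * I)) + 1 := by
    rw [neg_mul]; ring
  rw [e, hprod, ← h2]; ring

/-- [folklore] **THE SCALAR PART**: `Σ_a p̂_a(−p) p̂_a(p) = Δ¹(p)` (`B4Strip.Delta1 0 p = Σ_a S₁(p_a)`). -/
theorem sum_d1C_neg_mul (p : Fin (d + 1) → ℂ) : ∑ a, d1C (-p) a * d1C p a = Delta1 0 p := by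
  simp only [d1C_neg_mul_d1C, Delta1, Complex.ofReal_zero, add_zero]

/-! ## §2 The holomorphic Feynman matrix -/

/-- [our object] **THE WEIGHTED MAXWELL MATRIX WITH TWO MOMENTUM VECTORS**: `exC V p α β := Σ_μ Σ_{ν≠μ} ½V μ ν·curlRow (p̂(−p)) μ ν α·curlRow (p̂(p)) μ ν β`
(the holomorphic continuation of `maxwellMat V p̂`: at real momenta `conj (curlRow p̂ …) = curlRow (p̂(−·)) …`). -/
def exC (V : Fin (d + 1) → Fin (d + 1) → ℂ) (p : Fin (d + 1) → ℂ) : Matrix (Fin (d + 1)) (Fin (d + 1)) ℂ :=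
  fun α β => ∑ μ, ∑ ν, if μ = ν then 0 else V μ ν / 2 * (curlRow (d1C (-p)) μ ν α * curlRow (d1C p) μ ν β)

/-- [our object] **THE HOLOMORPHIC FEYNMAN-COMPLETED MAXWELL MATRIX OF THE PERFECT ACTION**: `feynC p := exC (W^{per}(p)) p + p̂(p) ⊗ p̂(−p)`. -/
def feynC (p : Fin (d + 1) → ℂ) : Matrix (Fin (d + 1)) (Fin (d + 1)) ℂ :=
  fun α β => exC (fun μ ν => Wper μ ν p) p α β + d1C p α * d1C (-p) β

/-- [our object] **THE HOLOMORPHIC PERFECT PROPAGATOR SYMBOL** `PC p := (feynC p)⁻¹` (Mathlib's matrix inverse; the genuine inverse wherever `det ≠ 0`). -/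
def PC (p : Fin (d + 1) → ℂ) : Matrix (Fin (d + 1)) (Fin (d + 1)) ℂ := (feynC p)⁻¹

/-- [folklore] `exC` is additive in the weights. -/
theorem exC_add (V V' : Fin (d + 1) → Fin (d + 1) → ℂ) (p : Fin (d + 1) → ℂ) (α β : Fin (d + 1)) :
    exC (fun μ ν => V μ ν + V' μ ν) p α β = exC V p α β + exC V' p α β := by
  simp only [exC, ← Finset.sum_add_distrib]
  refine Finset.sum_congr rfl fun μ _ => Finset.sum_congr rfl fun ν _ => ?_
  split_ifs <;> ring

/-- [folklore] the diagonal guard is void: the curl row of `(μ, μ)` vanishes. -/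
theorem exC_eq_sum (V : Fin (d + 1) → Fin (d + 1) → ℂ) (p : Fin (d + 1) → ℂ) (α β : Fin (d + 1)) :
    exC V p α β = ∑ μ, ∑ ν, V μ ν / 2 * (curlRow (d1C (-p)) μ ν α * curlRow (d1C p) μ ν β) := by
  refine Finset.sum_congr rfl fun μ _ => Finset.sum_congr rfl fun ν _ => ?_
  split_ifs with h
  · subst h; rw [curlRow_self, curlRow_self]; ring
  · rfl

/-- [folklore] corner sum 1: `Σ_μ Σ_ν [α=ν]phb μ·[β=ν]ph μ = [α=β]·Σ_μ phb μ ph μ`. -/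
theorem corner₁ (ph phb : Fin (d + 1) → ℂ) (α β : Fin (d + 1)) :
    ∑ μ, ∑ ν, (if α = ν then phb μ else 0) * (if β = ν then ph μ else 0) = if α = β then ∑ μ, phb μ * ph μ else 0 := by
  by_cases h : α = β
  · subst h
    simp only [if_true]
    refine Finset.sum_congr rfl fun μ _ => ?_
    rw [Finset.sum_eq_single α (fun ν _ hν => by rw [if_neg (Ne.symm hν), zero_mul]) (fun h => absurd (Finset.mem_univ α) h)]
    simp
  · rw [if_neg h]
    refine Finset.sum_eq_zero fun μ _ => Finset.sum_eq_zero fun ν _ => ?_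
    by_cases h1 : α = ν
    · have h2 : ¬ β = ν := fun h2 => h (h1.trans h2.symm)
      rw [if_neg h2, mul_zero]
    · rw [if_neg h1, zero_mul]

/-- [folklore] corner sum 2: `Σ_μ Σ_ν [α=ν]phb μ·[β=μ]ph ν = phb β·ph α`. -/
theorem corner₂ (ph phb : Fin (d + 1) → ℂ) (α β : Fin (d + 1)) :
    ∑ μ, ∑ ν, (if α = ν then phb μ else 0) * (if β = μ then ph ν else 0) = phb β * ph α := by
  rw [Finset.sum_eq_single β (fun μ _ hμ => Finset.sum_eq_zero fun ν _ => by rw [if_neg (Ne.symm hμ), mul_zero])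
    (fun h => absurd (Finset.mem_univ β) h)]
  rw [Finset.sum_eq_single α (fun ν _ hν => by rw [if_neg (Ne.symm hν), zero_mul]) (fun h => absurd (Finset.mem_univ α) h)]
  simp

/-- [folklore] corner sum 3: `Σ_μ Σ_ν [α=μ]phb ν·[β=ν]ph μ = phb β·ph α`. -/
theorem corner₃ (ph phb : Fin (d + 1) → ℂ) (α β : Fin (d + 1)) :
    ∑ μ, ∑ ν, (if α = μ then phb ν else 0) * (if β = ν then ph μ else 0) = phb β * ph α := by
  rw [Finset.sum_eq_single α (fun μ _ hμ => Finset.sum_eq_zero fun ν _ => by rw [if_neg (Ne.symm hμ), zero_mul])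
    (fun h => absurd (Finset.mem_univ α) h)]
  rw [Finset.sum_eq_single β (fun ν _ hν => by rw [if_neg (Ne.symm hν), mul_zero]) (fun h => absurd (Finset.mem_univ β) h)]
  simp

/-- [folklore] corner sum 4: `Σ_μ Σ_ν [α=μ]phb ν·[β=μ]ph ν = [α=β]·Σ_ν phb ν ph ν`. -/
theorem corner₄ (ph phb : Fin (d + 1) → ℂ) (α β : Fin (d + 1)) :
    ∑ μ, ∑ ν, (if α = μ then phb ν else 0) * (if β = μ then ph ν else 0) = if α = β then ∑ ν, phb ν * ph ν else 0 := by
  rw [Finset.sum_comm]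
  convert corner₁ ph phb α β using 1

/-- [folklore] **CONSTANT WEIGHTS ARE SCALAR UP TO THE GAUGE TERM**: `exC 1 p α β = [α = β]·Δ¹(p) − p̂_α(p)·p̂_β(−p)` (the lattice Maxwell symbol
`|p̂|²𝟙 − p̂p̂†`, continued). -/
theorem exC_one (p : Fin (d + 1) → ℂ) (α β : Fin (d + 1)) :
    exC (fun _ _ => (1 : ℂ)) p α β = (if α = β then Delta1 0 p else 0) - d1C p α * d1C (-p) β := by
  rw [exC_eq_sum]
  have e : ∀ μ ν : Fin (d + 1), (1 : ℂ) / 2 * (curlRow (d1C (-p)) μ ν α * curlRow (d1C p) μ ν β)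
      = (1 / 2 : ℂ) * ((if α = ν then d1C (-p) μ else 0) * (if β = ν then d1C p μ else 0)
        - (if α = ν then d1C (-p) μ else 0) * (if β = μ then d1C p ν else 0)
        - (if α = μ then d1C (-p) ν else 0) * (if β = ν then d1C p μ else 0)
        + (if α = μ then d1C (-p) ν else 0) * (if β = μ then d1C p ν else 0)) := by
    intro μ ν; simp only [curlRow]; ring
  simp only [e, ← Finset.mul_sum, Finset.sum_add_distrib, Finset.sum_sub_distrib, corner₁, corner₂, corner₃, corner₄,
    sum_d1C_neg_mul]
  split_ifs <;> ring

/-- [our object] **THE SCALAR ∕ EXCESS SPLIT OF THE HOLOMORPHIC FEYNMAN MATRIX**: `feynC p α β = [α = β]·Δ¹(p) + exC (W^{per}(p) − 1) p α β`. -/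
theorem feynC_eq_Delta1_add_exC (p : Fin (d + 1) → ℂ) (α β : Fin (d + 1)) :
    feynC p α β = (if α = β then Delta1 0 p else 0) + exC (fun μ ν => Wper μ ν p - 1) p α β := by
  have h : exC (fun μ ν => Wper μ ν p) p α β = exC (fun μ ν => (Wper μ ν p - 1) + 1) p α β := by simp
  rw [feynC, h, exC_add (fun μ ν => Wper μ ν p - 1) (fun _ _ => (1 : ℂ)) p α β, exC_one]
  ring

/-! ## §3 The dictionary at real momenta -/

/-- [folklore] `conj` passes through a curl row: `conj (curlRow ph μ ν α) = curlRow (conj ∘ ph) μ ν α`. -/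
theorem conj_curlRow (ph : Fin (d + 1) → ℂ) (μ ν α : Fin (d + 1)) :
    conj (curlRow ph μ ν α) = curlRow (fun a => conj (ph a)) μ ν α := by
  simp only [curlRow, map_sub, apply_ite conj, map_zero]

/-- [our object] at real vectors `W^{per} = W_∞(wrapPt ·)`. -/
theorem Wper_ofRealVec (μ ν : Fin (d + 1)) (s : Fin (d + 1) → ℝ) : Wper μ ν (ofRealVec s) = W166Inf μ ν (ofRealVec (wrapPt s)) := by
  rw [Wper, wrapC_ofRealVec]

/-- [our object] **AT REAL MOMENTA THE PERIODIC WEIGHT IS THE REAL NUMBER `Re W_∞(wrapPt s)`** (`μ ≠ ν`). -/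
theorem Wper_ofRealVec_eq_re {μ ν : Fin (d + 1)} (hμν : μ ≠ ν) (s : Fin (d + 1) → ℝ) :
    Wper μ ν (ofRealVec s) = (((W166Inf μ ν (ofRealVec (wrapPt s))).re : ℝ) : ℂ) := by
  rw [Wper_ofRealVec]
  exact W166Inf_ofReal_eq_re_of_mem hμν (wrapPt_mem_BZ s)

/-- [our object] **THE DICTIONARY: AT REAL MOMENTA THE HOLOMORPHIC FEYNMAN MATRIX IS THE TREE'S `feynMat` AT THE WRAPPED POINT**:
`feynC (ofRealVec s) = feynMat (Re W_∞(·,·; wrapPt s)) (d1Sym (wrapPt s))`. -/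
theorem feynC_ofRealVec (s : Fin (d + 1) → ℝ) :
    feynC (ofRealVec s) = feynMat (fun μ ν => (W166Inf μ ν (ofRealVec (wrapPt s))).re) (d1Sym (wrapPt s)) := by
  ext α β
  rw [d1Sym_wrapPt]
  simp only [feynC, feynMat, maxwellMat, exC]
  congr 1
  · refine Finset.sum_congr rfl fun μ _ => Finset.sum_congr rfl fun ν _ => ?_
    by_cases hμν : μ = ν
    · simp [hμν]
    · rw [if_neg hμν, if_neg hμν, conj_curlRow, star_d1C_ofRealVec, Wper_ofRealVec_eq_re hμν]
      push_cast; ring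
  · rw [conj_d1C_ofRealVec]

/-- [our object] **`PC (ofRealVec s) = PbfSym (ofRealVec s)`, EVERY REAL `s`** — leaf-02-g7's coarse-covariance symbol of record `covSymMean n κ λ (PbfSym κ λ)`
is `covSymMean n κ λ (fun p ↦ PC p κ λ)` on the real zone. -/
theorem PC_ofRealVec (s : Fin (d + 1) → ℝ) (κ l : Fin (d + 1)) : PC (ofRealVec s) κ l = PbfSym κ l (ofRealVec s) := by
  rw [PbfSym_ofRealVec, PC, feynC_ofRealVec, PinfSym]

/-- [folklore] on the closed zone `W_∞(s) = W_∞(wrapPt s)` (`μ ≠ ν`): the coordinates with `s_i = −π` wrap to `π`, where the values agree by the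
several-coordinate side matching `W166Inf_shiftS` of file (W). -/
theorem W166Inf_ofRealVec_wrapPt {μ ν : Fin (d + 1)} (hμν : μ ≠ ν) {s : Fin (d + 1) → ℝ} (hs : s ∈ BZ (d + 1)) :
    W166Inf μ ν (ofRealVec s) = W166Inf μ ν (ofRealVec (wrapPt s)) := by
  set S : Finset (Fin (d + 1)) := Finset.univ.filter fun i => s i = -Real.pi with hSdef
  have hq : ofRealVec (wrapPt s) ∈ Strip (d + 1) 0 := by
    intro i
    refine ⟨?_, by simp [ofRealVec]⟩
    simp only [ofRealVec, Complex.ofReal_re]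
    exact abs_le.mpr ⟨(wrapPt_mem_Ioc s i).1.le, (wrapPt_mem_Ioc s i).2⟩
  have hBZ : ∀ i, -Real.pi ≤ s i ∧ s i ≤ Real.pi := fun i => by
    have h := hs; unfold BZ at h; rw [Set.mem_Icc] at h; exact ⟨h.1 i, h.2 i⟩
  -- coordinates not equal to `−π` are unchanged by the wrap; those equal to `−π` become `π`
  have hw : ∀ i, wrapPt s i = if s i = -Real.pi then Real.pi else s i := by
    intro i
    split_ifs with h
    · unfold wrapPt; rw [h]
      have e : (-Real.pi : ℝ) = Real.pi + (-1 : ℤ) • (2 * Real.pi) := by simp; ring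
      rw [e, toIocMod_add_zsmul, toIocMod_eq_self]
      constructor <;> linarith [Real.pi_pos]
    · unfold wrapPt; rw [toIocMod_eq_self]
      refine ⟨lt_of_le_of_ne (hBZ i).1 (Ne.symm h), by linarith [(hBZ i).2]⟩
  have hre : ∀ i ∈ S, (ofRealVec (wrapPt s) i).re = Real.pi := by
    intro i hi
    have h : s i = -Real.pi := (Finset.mem_filter.mp hi).2
    simp [ofRealVec, hw i, h]
  have hshift : shiftS S (ofRealVec (wrapPt s)) = ofRealVec s := by
    funext i
    by_cases h : s i = -Real.pi
    · have hi : i ∈ S := Finset.mem_filter.mpr ⟨Finset.mem_univ i, h⟩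
      simp only [shiftS, hi, if_true, ofRealVec, hw i, h]
      push_cast; ring
    · have hi : i ∉ S := fun hi => h (Finset.mem_filter.mp hi).2
      simp only [shiftS, hi, if_false, ofRealVec, hw i, h, if_false]
  have h := W166Inf_shiftS le_rfl (kappa166_pos (d + 1)).le hμν S (ofRealVec (wrapPt s)) hq hre
  rw [hshift] at h
  exact h

/-- [our object] **ON THE CLOSED REAL ZONE `PC (ofRealVec s) = PinfSym s (d1Sym s)`** — the hypothesis `hG₀` of leaf-02-g7's
`CoarseCovarianceAliasBF.coarseCovMean_latticeKernel_BF` ∕ `latticeKernel_eq_PbfSym` for `G₀ := fun p ↦ PC p κ λ`. -/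
theorem PC_ofRealVec_of_mem_BZ {s : Fin (d + 1) → ℝ} (hs : s ∈ BZ (d + 1)) (κ l : Fin (d + 1)) :
    PC (ofRealVec s) κ l = PinfSym s (d1Sym s) κ l := by
  rw [PC, feynC_ofRealVec, PinfSym, d1Sym_wrapPt, d1C_ofRealVec,
    feynMat_congr_offDiag (W' := fun μ ν => (W166Inf μ ν (ofRealVec s)).re)
      (fun μ ν hμν => by simp only [W166Inf_ofRealVec_wrapPt hμν hs]) (d1Sym s)]

end Summit.QuantumFields.BalabanUV.Beta.FP.CoarseCovarianceStripFeyn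

end
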